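import Literature.NumberTheory.LFunctions.IwaniecSarnakFamilyAmplifiedEvenShare
import Literature.NumberTheory.LFunctions.KowalskiMichelPeterssonFormula
import HarnessLib

/-!
# Even share of an amplified harmonic measure at prime level — RE-THREADED to the printed range of
# the Petersson bound (`kowalskiMichel2000_peterssonBound`, R2-G44)

Topic `Literature/NumberTheory/LFunctions` (namespace
`Literature.NumberTheory.LFunctions.CentralValueFamilyHalfEdge`). PROOFS only — NO named fact (D-0026).
Companion («`_pb` twins») of `IwaniecSarnakFamilyAmplifiedEvenShare.lean`, whose theorems take the
hypothesis `(hP : KowalskiMichel2000.kowalskiMichel2000_petersson)` — the Petersson display of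
Kowalski–Michel 2000 p. 310 typed for ALL `m, n ≥ 1`, which is FALSE at `m = n = q`
(`KowalskiMichel2000.not_kowalskiMichel2000_petersson`; cell record R2-G44, «refuted-as-typed ≠
refuted-in-print»). Here every such theorem is re-proved VERBATIM from the fact IN ITS PRINTED RANGE,
`KowalskiMichel2000.kowalskiMichel2000_peterssonBound` (binder `¬ (q ∣ m ∧ q ∣ n)`, i.e. `((m,n),q) = 1` at prime `q`;
KM2000 §2.3 p. 310 display after (16) and §2.4.2 (23)), the old declarations being left
untouched (append-only discipline):

* `pairSum_bounds_pb` — the pair-sum bounds with the extra binder `¬ (q ∣ ℓ ∧ q ∣ ℓ′)` in the statement;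
* `evenShare_ampPrimeFamilyTwo_pb` — the even share of the amplified measure; the side condition is
  discharged INSIDE the proof: sublinear cubes force every amplifier prime `ℓ ∈ S_q` below `q` at large
  `q` (`ℓ ≤ ℓ³ ≤ Σ_S ℓ³ ≤ q/8 < q`), so `q ∤ ℓ`;
* `lOne_lowerBound_ampPrimeFamilyTwo_total_pb` — the amplified decision theorem, re-threaded.

No use is made anywhere of the negation of the old fact (smuggling rule of the R2-G44 ruling).
«The programme SEARCHES and TYPES; no claim about Landau–Siegel zeros, Theorems 1–2 of arXiv:2211.02515
or a repaired Margin232 until a kernel theorem says so.»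

## References

* [KowalskiMichel2000] Acta Arith. 94 (2000), §2.3 display after (16) IN ITS RANGE (§2.4.2 (23),
  `(m, q) = 1`), Lemma 1 (typed facts `KowalskiMichel2000.kowalskiMichel2000_peterssonBound`,
  `kowalskiMichel2000_lemma1`).
* [IwaniecConversations2006] §7 (7.3), (7.7).
-/

noncomputable section

namespace Literature.NumberTheory.LFunctions.CentralValueFamilyHalfEdge

open scoped MatrixGroups
open Finset Real CongruenceSubgroup Complex
open Literature.NumberTheory.EllipticCurves.ModularForms
open Literature.NumberTheory.LFunctions.IwaniecSarnak

/-- **Pair-sum bounds from the Petersson facts IN THEIR PRINTED RANGE**: `|H(ℓ,ℓ′) − δ| ≤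
C₁(ℓℓ′)^{3/2}q^{−3/2}` and `|2H⁻(ℓ,ℓ′) − δ| ≤ C₂(ℓℓ′)^{3/2}q^{−1}` for prime `q`, `1 ≤ ℓ, ℓ′`, `ℓ′ ≤ q`
and `¬ (q ∣ ℓ ∧ q ∣ ℓ′)` (re-thread of `pairSum_bounds` to `kowalskiMichel2000_peterssonBound`, R2-G44).
[cite: KowalskiMichel2000, §2.3 (display after (16)) with §2.4.2 (23), and Lemma 1] -/
theorem pairSum_bounds_pb (hP : KowalskiMichel2000.kowalskiMichel2000_peterssonBound)
    (hL : KowalskiMichel2000.kowalskiMichel2000_lemma1) :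
    ∃ C₁ C₂ : ℝ, 0 ≤ C₁ ∧ 0 ≤ C₂ ∧ ∀ (q : ℕ) [NeZero q], q.Prime → ∀ l m : ℕ, 1 ≤ l → 1 ≤ m → m ≤ q →
      ¬ (q ∣ l ∧ q ∣ m) →
      |pairSum q l m - (if l = m then 1 else 0)| ≤ C₁ * (((l : ℝ) * m) ^ (3 / 2 : ℝ)) * (q : ℝ) ^ (-(3 / 2 : ℝ)) ∧
      |2 * pairSumOdd q l m - (if l = m then 1 else 0)| ≤ C₂ * (((l : ℝ) * m) ^ (3 / 2 : ℝ)) / q := by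
  obtain ⟨C₁, h₁⟩ := hP 1 one_pos
  obtain ⟨C₂, h₂⟩ := hL 1 one_pos
  have e32 : (1 / 2 + 1 : ℝ) = 3 / 2 := by norm_num
  refine ⟨max C₁ 0, max C₂ 0, le_max_right _ _, le_max_right _ _,
    fun q _ hq l m hl hm hmq hnd => ⟨?_, ?_⟩⟩
  · have h := h₁ q hq l m hl hm hnd
    rw [pet_eq_pairSum] at h
    have e : (((pairSum q l m : ℝ) : ℂ) - (if l = m then 1 else 0)) =
        (((pairSum q l m - (if l = m then 1 else 0) : ℝ)) : ℂ) := by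
      split_ifs <;> push_cast <;> ring
    rw [e, Complex.norm_real, Real.norm_eq_abs, e32] at h
    exact le_trans h (mul_le_mul_of_nonneg_right (mul_le_mul_of_nonneg_right (le_max_left _ _)
      (by positivity)) (by positivity))
  · have h := h₂ q hq l m hl hm hmq
    rw [deltaMinus_eq_pairSumOdd] at h
    have e : (2 * ((pairSumOdd q l m : ℝ) : ℂ) - (if l = m then 1 else 0)) =
        (((2 * pairSumOdd q l m - (if l = m then 1 else 0) : ℝ)) : ℂ) := by
      split_ifs <;> push_cast <;> ring
    rw [e, Complex.norm_real, Real.norm_eq_abs, e32] at h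
    refine le_trans h ?_
    exact div_le_div_of_nonneg_right (mul_le_mul_of_nonneg_right (le_max_left _ _) (by positivity))
      (by positivity)

section Expand

variable {S : ℕ+ → Finset ℕ} {c : ℕ+ → ℕ → ℝ}

/-- The diagonal: `Σ_{ℓ,ℓ′} c_ℓ c_{ℓ′} δ(ℓ,ℓ′) = Σ c_ℓ²`. [folklore] -/
private theorem sum_sum_delta_pb (N : ℕ+) :
    ∑ l ∈ S N, ∑ m ∈ S N, c N l * c N m * (if l = m then (1 : ℝ) else 0) = ∑ l ∈ S N, c N l ^ 2 := by
  refine Finset.sum_congr rfl fun l hl => ?_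
  simp only [mul_ite, mul_one, mul_zero, Finset.sum_ite_eq, if_pos hl, sq]

/-- Error control by Cauchy–Schwarz (as in the companion file, with the pair condition restricted to
`S × S`): if `|X(ℓ,ℓ′) − δ(ℓ,ℓ′)| ≤ K·(ℓℓ′)^{3/2}` on `S × S` then `|Σ c c′ X − Σ c²| ≤ K·(Σ_S ℓ³)·Σ c²`.
[folklore] -/
private theorem bilinear_error_pb {X : ℕ → ℕ → ℝ} {K : ℝ} (hK : 0 ≤ K) (N : ℕ+)
    (hX : ∀ l ∈ S N, ∀ m ∈ S N, |X l m - (if l = m then 1 else 0)| ≤ K * (((l : ℝ) * m) ^ (3 / 2 : ℝ))) :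
    |∑ l ∈ S N, ∑ m ∈ S N, c N l * c N m * X l m - ∑ l ∈ S N, c N l ^ 2| ≤
      K * (∑ l ∈ S N, ((l : ℝ)) ^ 3) * ∑ l ∈ S N, c N l ^ 2 := by
  have hsplit : ∑ l ∈ S N, ∑ m ∈ S N, c N l * c N m * X l m - ∑ l ∈ S N, c N l ^ 2 =
      ∑ l ∈ S N, ∑ m ∈ S N, c N l * c N m * (X l m - (if l = m then 1 else 0)) := by
    rw [← sum_sum_delta_pb N, ← Finset.sum_sub_distrib]
    refine Finset.sum_congr rfl fun l _ => ?_
    rw [← Finset.sum_sub_distrib]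
    refine Finset.sum_congr rfl fun m _ => ?_
    ring
  rw [hsplit]
  set w : ℕ → ℝ := fun l => |c N l| * ((l : ℝ)) ^ (3 / 2 : ℝ) with hw
  have hterm : ∀ l ∈ S N, ∀ m ∈ S N,
      |c N l * c N m * (X l m - (if l = m then 1 else 0))| ≤ K * (w l * w m) := by
    intro l hl m hm
    rw [abs_mul, abs_mul]
    have h := hX l hl m hm
    have hlm : (((l : ℝ) * m) ^ (3 / 2 : ℝ)) = ((l : ℝ)) ^ (3 / 2 : ℝ) * ((m : ℝ)) ^ (3 / 2 : ℝ) :=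
      Real.mul_rpow (Nat.cast_nonneg l) (Nat.cast_nonneg m)
    calc |c N l| * |c N m| * |X l m - (if l = m then 1 else 0)|
        ≤ |c N l| * |c N m| * (K * (((l : ℝ) * m) ^ (3 / 2 : ℝ))) :=
          mul_le_mul_of_nonneg_left h (by positivity)
      _ = K * (w l * w m) := by rw [hlm, hw]; ring
  have hbound : |∑ l ∈ S N, ∑ m ∈ S N, c N l * c N m * (X l m - (if l = m then 1 else 0))| ≤
      K * (∑ l ∈ S N, w l) ^ 2 := by
    calc |∑ l ∈ S N, ∑ m ∈ S N, c N l * c N m * (X l m - (if l = m then 1 else 0))|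
        ≤ ∑ l ∈ S N, |∑ m ∈ S N, c N l * c N m * (X l m - (if l = m then 1 else 0))| :=
          Finset.abs_sum_le_sum_abs _ _
      _ ≤ ∑ l ∈ S N, ∑ m ∈ S N, |c N l * c N m * (X l m - (if l = m then 1 else 0))| :=
          Finset.sum_le_sum fun l _ => Finset.abs_sum_le_sum_abs _ _
      _ ≤ ∑ l ∈ S N, ∑ m ∈ S N, K * (w l * w m) :=
          Finset.sum_le_sum fun l hl => Finset.sum_le_sum fun m hm => hterm l hl m hm
      _ = K * (∑ l ∈ S N, w l) ^ 2 := by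
          rw [sq, Finset.sum_mul_sum, Finset.mul_sum]
          refine Finset.sum_congr rfl fun l _ => ?_
          rw [Finset.mul_sum]
  have hCS : (∑ l ∈ S N, w l) ^ 2 ≤ (∑ l ∈ S N, ((l : ℝ)) ^ 3) * ∑ l ∈ S N, c N l ^ 2 := by
    have h := Finset.sum_mul_sq_le_sq_mul_sq (S N) (fun l => ((l : ℝ)) ^ (3 / 2 : ℝ)) (fun l => |c N l|)
    have e1 : ∀ l ∈ S N, (((l : ℝ)) ^ (3 / 2 : ℝ)) ^ 2 = ((l : ℝ)) ^ 3 := by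
      intro l _
      rw [← Real.rpow_natCast, ← Real.rpow_mul (Nat.cast_nonneg l)]
      norm_num
    have e2 : ∀ l ∈ S N, |c N l| ^ 2 = c N l ^ 2 := fun l _ => sq_abs _
    rw [Finset.sum_congr rfl e1, Finset.sum_congr rfl e2] at h
    have e3 : ∑ l ∈ S N, ((l : ℝ)) ^ (3 / 2 : ℝ) * |c N l| = ∑ l ∈ S N, w l :=
      Finset.sum_congr rfl fun l _ => by rw [hw]; ring
    rw [e3] at h
    exact h
  exact le_trans hbound (by rw [mul_assoc]; exact mul_le_mul_of_nonneg_left hCS hK)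

end Expand

open scoped Classical in
/-- The even amplified mass is the total minus the odd-restricted one. [cite: IwaniecConversations2006, §7 (7.3)] -/
private theorem harmonicSum_even_eq_sub_pb {N : ℕ} [NeZero N] (X : CuspForm (Gamma0 N) 2 → ℝ) :
    harmonicSum N 2 (fun f => if rootNumber f = 1 then X f else 0) =
      harmonicSum N 2 X - harmonicSum N 2 (fun f => if rootNumber f = 1 then 0 else X f) := by
  have hfin : (newforms0 N (2 : ℤ)).Finite := finite_newforms0_holds N (2 : ℤ)
  rw [harmonicSum_eq_sum hfin, harmonicSum_eq_sum hfin, harmonicSum_eq_sum hfin,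
    ← Finset.sum_sub_distrib]
  refine Finset.sum_congr rfl fun f _ => ?_
  split_ifs <;> ring

/-- **Even share of the amplified measure at prime level, weight `2`, from the Petersson facts IN
THEIR PRINTED RANGE** (re-thread of `evenShare_ampPrimeFamilyTwo` to `kowalskiMichel2000_peterssonBound`,
R2-G44): for a linear amplifier with sublinear cubes and `Σ c² > 0`, at all large prime levels
`Σ^h_{even} ω A² ≥ ⅕·Σ^h ω A² > 0`. The range condition `q ∤ ℓ` holds because sublinear cubes put every
`ℓ ∈ S_q` below `q` at large `q`. [cite: KowalskiMichel2000, §2.3 (display after (16)) with §2.4.2 (23), and Lemma 1] -/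
theorem evenShare_ampPrimeFamilyTwo_pb {S : ℕ+ → Finset ℕ} {c : ℕ+ → ℕ → ℝ}
    (hP : KowalskiMichel2000.kowalskiMichel2000_peterssonBound)
    (hL : KowalskiMichel2000.kowalskiMichel2000_lemma1) (hS : SublinearCubes S)
    (hc : ∀ N : ℕ+, 0 < ∑ l ∈ S N, c N l ^ 2) : (ampPrimeFamilyTwo S c).EvenShare := by
  classical
  obtain ⟨C₁, C₂, hC₁, hC₂, hB⟩ := pairSum_bounds_pb hP hL
  obtain ⟨hrange, hsub⟩ := hS
  -- choose ε with C₁ ε ≤ 1/8 and C₂ ε ≤ 1/4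
  set ε : ℝ := 1 / (8 * (C₁ + C₂ + 1)) with hεdef
  have hε : 0 < ε := by rw [hεdef]; positivity
  have hε8 : ε ≤ 1 / 8 := by
    rw [hεdef]
    rw [div_le_div_iff_of_pos_left one_pos (by positivity) (by norm_num)]
    linarith
  obtain ⟨N₀, hN₀⟩ := hsub ε hε
  refine ⟨1 / 5, by norm_num, ((N₀ : ℝ) + 1),
    fun (N : ℕ+) (hadm : Squarefree (N : ℕ) ∧ (N : ℕ).Prime)
      (hsz : (N₀ : ℝ) + 1 ≤ ((N : ℕ) : ℝ)) => ?_⟩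
  obtain ⟨_, hprime⟩ := hadm
  set q : ℕ := (N : ℕ) with hqdef
  have hq1 : (1 : ℝ) ≤ q := by exact_mod_cast hprime.one_lt.le
  have hqpos : (0 : ℝ) < q := lt_of_lt_of_le one_pos hq1
  have hN₀' : N₀ ≤ q := by exact_mod_cast (by linarith : (N₀ : ℝ) ≤ q)
  have hcube := hN₀ N hN₀'
  -- the printed range: every amplifier index lies below `q`, so `q ∤ ℓ`
  have hnd : ∀ l ∈ S N, ∀ m ∈ S N, ¬ (q ∣ l ∧ q ∣ m) := by
    intro l hl m _ hdiv
    have hl1 : 1 ≤ l := (hrange N l hl).1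
    have hl3 : ((l : ℝ)) ^ 3 ≤ ∑ l ∈ S N, ((l : ℝ)) ^ 3 :=
      Finset.single_le_sum (f := fun i : ℕ => ((i : ℝ)) ^ 3) (fun i _ => by positivity) hl
    have hll : (l : ℝ) ≤ ((l : ℝ)) ^ 3 := by
      exact_mod_cast Nat.le_self_pow (by norm_num) l
    have hlt : (l : ℝ) < q := by
      have : ((l : ℝ)) ^ 3 ≤ ε * q := le_trans hl3 hcube
      nlinarith
    have hle : q ≤ l := Nat.le_of_dvd (by omega) hdiv.1
    exact absurd (by exact_mod_cast hle : (q : ℝ) ≤ l) (not_le.2 hlt)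
  -- rewrite the masses
  show 1 / 5 * (iwaniecSarnakFamilyAmp 2 (linAmp S c)).totalMass N ≤
      (iwaniecSarnakFamilyAmp 2 (linAmp S c)).evenMass N ∧
    0 < (iwaniecSarnakFamilyAmp 2 (linAmp S c)).totalMass N
  rw [totalMass_iwaniecSarnakFamilyAmp, evenMass_iwaniecSarnakFamilyAmp, harmonicSum_even_eq_sub_pb,
    harmonicSum_linAmp_sq, harmonicSum_linAmp_sq_odd]
  set T := ∑ l ∈ S N, ∑ m ∈ S N, c N l * c N m * pairSum q l m with hT
  set O := ∑ l ∈ S N, ∑ m ∈ S N, c N l * c N m * pairSumOdd q l m with hO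
  set V := ∑ l ∈ S N, c N l ^ 2 with hV
  set B := ∑ l ∈ S N, ((l : ℝ)) ^ 3 with hBdef
  have hVpos : 0 < V := hc N
  -- total: |T − V| ≤ C₁ q^{-3/2} B V ≤ C₁ ε V ≤ V/8
  have hTerr : |T - V| ≤ C₁ * (q : ℝ) ^ (-(3 / 2 : ℝ)) * B * V := by
    have h := bilinear_error_pb (S := S) (c := c) (X := fun l m => pairSum q l m)
      (K := C₁ * (q : ℝ) ^ (-(3 / 2 : ℝ))) (by positivity) N (fun l hl m hm => by
        have hb := (hB q hprime l m (hrange N l hl).1 (hrange N m hm).1 (hrange N m hm).2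
          (hnd l hl m hm)).1
        calc |pairSum q l m - (if l = m then 1 else 0)|
            ≤ C₁ * (((l : ℝ) * m) ^ (3 / 2 : ℝ)) * (q : ℝ) ^ (-(3 / 2 : ℝ)) := hb
          _ = C₁ * (q : ℝ) ^ (-(3 / 2 : ℝ)) * (((l : ℝ) * m) ^ (3 / 2 : ℝ)) := by ring)
    simpa [hT, hV, hBdef, mul_assoc] using h
  -- odd: |2O − V| ≤ C₂ q^{-1} B V
  have hOerr : |2 * O - V| ≤ C₂ / q * B * V := by
    have h := bilinear_error_pb (S := S) (c := c) (X := fun l m => 2 * pairSumOdd q l m)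
      (K := C₂ / q) (by positivity) N (fun l hl m hm => by
        have hb := (hB q hprime l m (hrange N l hl).1 (hrange N m hm).1 (hrange N m hm).2
          (hnd l hl m hm)).2
        calc |2 * pairSumOdd q l m - (if l = m then 1 else 0)|
            ≤ C₂ * (((l : ℝ) * m) ^ (3 / 2 : ℝ)) / q := hb
          _ = C₂ / q * (((l : ℝ) * m) ^ (3 / 2 : ℝ)) := by ring)
    have e : ∑ l ∈ S N, ∑ m ∈ S N, c N l * c N m * (2 * pairSumOdd q l m) = 2 * O := by
      rw [hO, Finset.mul_sum]
      refine Finset.sum_congr rfl fun l _ => ?_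
      rw [Finset.mul_sum]
      refine Finset.sum_congr rfl fun m _ => ?_
      ring
    rw [e] at h
    simpa [hV, hBdef, mul_assoc] using h
  -- the two error factors are small
  have hBε : B ≤ ε * q := hcube
  have hsum : 0 < C₁ + C₂ + 1 := by positivity
  have ha : C₁ * (q : ℝ) ^ (-(3 / 2 : ℝ)) * B ≤ 1 / 8 := by
    have hrpow : (q : ℝ) ^ (-(3 / 2 : ℝ)) ≤ (q : ℝ)⁻¹ := by
      rw [← Real.rpow_neg_one]
      exact Real.rpow_le_rpow_of_exponent_le hq1 (by norm_num)
    calc C₁ * (q : ℝ) ^ (-(3 / 2 : ℝ)) * B ≤ C₁ * (q : ℝ)⁻¹ * (ε * q) := by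
          apply mul_le_mul (mul_le_mul_of_nonneg_left hrpow hC₁) hBε (by rw [hBdef]; positivity)
            (by positivity)
      _ = C₁ * ε := by field_simp
      _ ≤ (C₁ + C₂ + 1) * ε := mul_le_mul_of_nonneg_right (by linarith) hε.le
      _ = 1 / 8 := by rw [hεdef]; field_simp
  have hb : C₂ / q * B ≤ 1 / 8 := by
    calc C₂ / q * B ≤ C₂ / q * (ε * q) := mul_le_mul_of_nonneg_left hBε (by positivity)
      _ = C₂ * ε := by field_simp
      _ ≤ (C₁ + C₂ + 1) * ε := mul_le_mul_of_nonneg_right (by linarith) hε.le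
      _ = 1 / 8 := by rw [hεdef]; field_simp
  have hT' : |T - V| ≤ 1 / 8 * V := le_trans hTerr (mul_le_mul_of_nonneg_right ha hVpos.le)
  have hO' : |2 * O - V| ≤ 1 / 8 * V := le_trans hOerr (mul_le_mul_of_nonneg_right hb hVpos.le)
  obtain ⟨hT1, hT2⟩ := abs_le.mp hT'
  obtain ⟨hO1, hO2⟩ := abs_le.mp hO'
  constructor
  · nlinarith
  · nlinarith

/-- **THE AMPLIFIED WEIGHT-2 DECISION THEOREM AT PRIME LEVEL, even share DISCHARGED, from the Petersson
facts IN THEIR PRINTED RANGE** (re-thread of `lOne_lowerBound_ampPrimeFamilyTwo_total` to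
`kowalskiMichel2000_peterssonBound`, R2-G44; all other binders verbatim).
[cite: IwaniecConversations2006, §7 (7.7)] -/
theorem lOne_lowerBound_ampPrimeFamilyTwo_total_pb {S : ℕ+ → Finset ℕ} {c : ℕ+ → ℕ → ℝ}
    (hLR : lapidRallis2003_theorem1_gl2Twist)
    (hP : KowalskiMichel2000.kowalskiMichel2000_peterssonBound)
    (hL : KowalskiMichel2000.kowalskiMichel2000_lemma1) (hS : SublinearCubes S)
    (hc : ∀ N : ℕ+, 0 < ∑ l ∈ S N, c N l ^ 2) {p₁ p₂ δ : ℝ} (hδ : 0 < δ)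
    (htot : (iwaniecSarnakFamilyAmp 2 (linAmp S c)).MixedOverTotalMass δ)
    (htw : (iwaniecSarnakFamilyAmp 2 (linAmp S c)).TwistedHalf p₂ 2 δ)
    (hE : (ampPrimeFamilyTwo S c).EStarFam p₁ 2) (hp : 1 < p₁ + p₂) :
    ∃ c₀ : ℝ, 0 < c₀ ∧ ∃ D₀ : ℕ, ∀ (D : ℕ) [NeZero D] (χ : DirichletCharacter ℂ D), D₀ ≤ D →
      χ.IsPrimitive → MulChar.IsQuadratic χ →
        c₀ * ((Real.log D) ^ 4)⁻¹ ≤ (χ.LFunction 1).re := by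
  obtain ⟨K, hK, hsup⟩ := ampPrimeFamilyTwo_compatibleSupply S c hδ
  have h := (ampPrimeFamilyTwo S c).lOne_lowerBound_of_EStarFam_total' hK
    (CentralValueFamily.refine_nonnegOn (iwaniecSarnakFamilyAmp_nonnegOn (linAmp S c) le_rfl hLR))
    (fun _ _ _ _ hcomp => CentralValueFamily.refine_compatible_B hcomp)
    (evenShare_ampPrimeFamilyTwo_pb hP hL hS hc)
    (CentralValueFamily.refine_mixedOverTotalMass htot) (CentralValueFamily.refine_twistedHalf htw)
    hE hp hsup
  simpa only [show (2 * 2 : ℕ) = 4 from rfl] using h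

end Literature.NumberTheory.LFunctions.CentralValueFamilyHalfEdge

end
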